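import Mathlib.Analysis.Calculus.Deriv.Add
import Mathlib.Analysis.Calculus.Deriv.Mul
import Mathlib.Analysis.Calculus.Deriv.Pow
import Mathlib.Analysis.Complex.Basic

/-!
# `OffTetraSectorKernel` (stmt-KontsevichZagierPeriods-10557), line `odd-hyperbolic-ladder`:
stub `stub_rootsPartialFractions`

**PURE ALGEBRA: the imaginary part of a logarithmic derivative.** If `w₀, …, w_{k−1}` are the roots
of `X^k − z` (with multiplicity: `∏ⱼ (x − wⱼ) = x^k − z` for all complex `x`) and `z ∉ ℝ`, then for
every real `t`
`Σⱼ Im wⱼ / ((1 − t Re wⱼ)² + (t Im wⱼ)²) = k t^{k−1} Im z / ((1 − t^k Re z)² + (t^k Im z)²)`.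

Proof. Reversing the polynomial, `Q(t) = ∏ⱼ (1 − wⱼ t) = 1 − z t^k` for all complex `t`
(put `x = t⁻¹` and multiply by `t^k`). Differentiating both sides (the product rule in logarithmic
form, and uniqueness of the derivative) gives, wherever no factor vanishes,
`Q(t) · Σⱼ (−wⱼ)/(1 − wⱼ t) = −k z t^{k−1}`, i.e. `Σⱼ wⱼ/(1 − wⱼ t) = k z t^{k−1}/(1 − z t^k)`.
No root is real (a real `w` has real `w^k = z`), so for REAL `t` no factor `1 − wⱼ t` vanishes
(its imaginary part is `−t Im wⱼ`, and the factor is `1` at `t = 0`), nor does `1 − z t^k`.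
Finally `Im (w/(1 − w t)) = Im w / ((1 − t Re w)² + (t Im w)²)` for real `t`
(`Im (w · conj (1 − w t)) = Im w`), and `Im` is additive.

References: D. Zagier, *The dilogarithm function* (2007), Ch. I §2 (the distribution relation of the
Bloch–Wigner function); M. Kontsevich, D. Zagier, *Periods* (2001), §1.2. No definitions.
-/

noncomputable section

namespace Summit.KontsevichZagierPeriods.HyperbolicBloch.OffTetraSectorKernel

/-- Product rule for a finite product in logarithmic form (over `ℂ`): if `fᵢ' = fᵢ · cᵢ` at `x`
then `(∏ fᵢ)' = (∏ fᵢ) · Σ cᵢ` at `x` (no non-vanishing needed). [folklore] -/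
theorem rootsPF_hasDerivAt_prod_log {ι : Type*} (s : Finset ι) {f : ι → ℂ → ℂ} {c : ι → ℂ}
    {x : ℂ} (h : ∀ i ∈ s, HasDerivAt (f i) (f i x * c i) x) :
    HasDerivAt (fun t => ∏ i ∈ s, f i t) ((∏ i ∈ s, f i x) * ∑ i ∈ s, c i) x := by
  classical
  induction s using Finset.induction_on with
  | empty => simpa using hasDerivAt_const x (1 : ℂ)
  | insert a s ha ih =>
    have h1 := (h a (Finset.mem_insert_self a s)).fun_mul
      (ih fun i hi => h i (Finset.mem_insert_of_mem hi))
    simp only [Finset.prod_insert ha, Finset.sum_insert ha]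
    exact h1.congr_deriv (by ring)

/-- The reversed polynomial: if `∏ⱼ (x − wⱼ) = x^k − z` for all `x` (`k ≥ 1`), then
`∏ⱼ (1 − wⱼ t) = 1 − z t^k` for all `t` (put `x = t⁻¹`, multiply by `t^k`). [folklore] -/
theorem rootsPF_prod_one_sub {k : ℕ} (hk : 1 ≤ k) {z : ℂ} {w : Fin k → ℂ}
    (hP : ∀ x : ℂ, ∏ j, (x - w j) = x ^ k - z) (t : ℂ) :
    ∏ j, (1 - w j * t) = 1 - z * t ^ k := by
  rcases eq_or_ne t 0 with rfl | ht
  · simp [zero_pow (Nat.one_le_iff_ne_zero.mp hk)]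
  · calc ∏ j, (1 - w j * t) = ∏ j, (t * (t⁻¹ - w j)) := by
          refine Finset.prod_congr rfl fun j _ => ?_
          rw [mul_sub, mul_inv_cancel₀ ht, mul_comm]
      _ = t ^ k * ∏ j, (t⁻¹ - w j) := by
          rw [Finset.prod_mul_distrib, Finset.prod_const, Finset.card_univ, Fintype.card_fin]
      _ = 1 - z * t ^ k := by
          rw [hP, mul_sub, inv_pow, mul_inv_cancel₀ (pow_ne_zero k ht)]
          ring

/-- The logarithmic derivative of `∏ⱼ (1 − wⱼ t) = 1 − z t^k` away from the zeros:
`Σⱼ wⱼ/(1 − wⱼ t) = k t^{k−1} z/(1 − z t^k)`. [folklore] -/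
theorem rootsPF_sum_div {k : ℕ} (hk : 1 ≤ k) {z : ℂ} {w : Fin k → ℂ}
    (hP : ∀ x : ℂ, ∏ j, (x - w j) = x ^ k - z) (t : ℂ) (hw : ∀ j, 1 - w j * t ≠ 0)
    (hzt : 1 - z * t ^ k ≠ 0) :
    ∑ j, w j / (1 - w j * t) = k * t ^ (k - 1) * z / (1 - z * t ^ k) := by
  have h1 : HasDerivAt (fun s => ∏ j, (1 - w j * s))
      ((∏ j, (1 - w j * t)) * ∑ j, (-(w j / (1 - w j * t)))) t := by
    refine rootsPF_hasDerivAt_prod_log _ fun j _ => ?_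
    have hd : HasDerivAt (fun s => 1 - w j * s) (-(w j * 1)) t :=
      ((hasDerivAt_id t).const_mul (w j)).const_sub 1
    refine hd.congr_deriv ?_
    rw [mul_one, mul_neg, mul_div_cancel₀ _ (hw j)]
  have h2 : HasDerivAt (fun s => 1 - z * s ^ k) (-(z * ((k : ℂ) * t ^ (k - 1)))) t :=
    ((hasDerivAt_pow k t).const_mul z).const_sub 1
  have hfun : (fun s => ∏ j, (1 - w j * s)) = fun s => 1 - z * s ^ k :=
    funext (rootsPF_prod_one_sub hk hP)
  rw [hfun, rootsPF_prod_one_sub hk hP t, Finset.sum_neg_distrib] at h1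
  have h3 := h1.unique h2
  rw [eq_div_iff hzt]
  linear_combination -h3

/-- For real `t`: `Im (w/(1 − w t)) = Im w / ((1 − t Re w)² + (t Im w)²)` (multiply numerator and
denominator by the conjugate; `w · conj w · t` is real). [folklore] -/
theorem rootsPF_div_im (w : ℂ) (t : ℝ) :
    (w / (1 - w * t)).im = w.im / ((1 - t * w.re) ^ 2 + (t * w.im) ^ 2) := by
  have hn : Complex.normSq (1 - w * t) = (1 - t * w.re) ^ 2 + (t * w.im) ^ 2 := by
    rw [Complex.normSq_apply]
    simp only [Complex.sub_re, Complex.one_re, Complex.mul_re, Complex.ofReal_re,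
      Complex.ofReal_im, mul_zero, sub_zero, Complex.sub_im, Complex.one_im, Complex.mul_im,
      zero_add, zero_sub]
    ring
  rw [Complex.div_im, hn, ← sub_div]
  congr 1
  simp only [Complex.sub_re, Complex.one_re, Complex.mul_re, Complex.ofReal_re,
    Complex.ofReal_im, mul_zero, sub_zero, Complex.sub_im, Complex.one_im, Complex.mul_im,
    zero_add, zero_sub]
  ring

/-- For real `t` and non-real `w` the factor `1 − w t` does not vanish (its imaginary part is
`−t Im w`, and it equals `1` at `t = 0`). [folklore] -/
theorem rootsPF_one_sub_mul_ne_zero {w : ℂ} (hw : w.im ≠ 0) (t : ℝ) : 1 - w * (t : ℂ) ≠ 0 := by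
  intro h
  have him := congrArg Complex.im h
  simp only [Complex.sub_im, Complex.one_im, Complex.mul_im, Complex.ofReal_re,
    Complex.ofReal_im, mul_zero, zero_add, zero_sub, Complex.zero_im, neg_eq_zero,
    mul_eq_zero, hw, false_or] at him
  subst him
  simp at h

/-- **Registered stub `stub_rootsPartialFractions`** (pure algebra): if `w₀, …, w_{k−1}` are the
roots of `X^k − z` (with multiplicity: `∏ⱼ (x − wⱼ) = x^k − z` for all complex `x`) and `z ∉ ℝ`,
then for every real `t`
`Σⱼ Im wⱼ / ((1 − t Re wⱼ)² + (t Im wⱼ)²) = k t^{k−1} Im z / ((1 − t^k Re z)² + (t^k Im z)²)` — the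
imaginary part of the logarithmic derivative `Σⱼ wⱼ/(1 − wⱼ t) = k z t^{k−1}/(1 − z t^k)` of
`∏ⱼ (1 − wⱼ t) = 1 − z t^k` (no root is real, so no denominator vanishes).
[cite: Zagier2007Dilogarithm, Ch. I §2] -/
theorem stub_rootsPartialFractions :
    ∀ (k : ℕ), 1 ≤ k → ∀ (z : ℂ) (w : Fin k → ℂ), (∀ x : ℂ, ∏ j, (x - w j) = x ^ k - z) → z.im ≠ 0 →
    ∀ t : ℝ, ∑ j, (w j).im / ((1 - t * (w j).re) ^ 2 + (t * (w j).im) ^ 2) =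
      k * t ^ (k - 1) * (z.im / ((1 - t ^ k * z.re) ^ 2 + (t ^ k * z.im) ^ 2)) := by
  intro k hk z w hP hz t
  -- every `w j` is a root of `X^k - z`, hence non-real
  have hroot : ∀ j, w j ^ k = z := fun j => by
    have h := hP (w j)
    rw [Finset.prod_eq_zero (Finset.mem_univ j) (sub_self _)] at h
    exact (sub_eq_zero.mp h.symm)
  have him : ∀ j, (w j).im ≠ 0 := fun j h0 => by
    apply hz
    have hre : w j = ((w j).re : ℂ) := Complex.ext (by simp) (by simp [h0])
    rw [← hroot j, hre, ← Complex.ofReal_pow, Complex.ofReal_im]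
  have hw : ∀ j, 1 - w j * (t : ℂ) ≠ 0 := fun j => rootsPF_one_sub_mul_ne_zero (him j) t
  have hzt : 1 - z * (t : ℂ) ^ k ≠ 0 := by
    rw [← Complex.ofReal_pow]
    exact rootsPF_one_sub_mul_ne_zero hz (t ^ k)
  have hC := rootsPF_sum_div hk hP t hw hzt
  have hR : ((k : ℂ) * (t : ℂ) ^ (k - 1) * z / (1 - z * (t : ℂ) ^ k)).im =
      k * t ^ (k - 1) * (z.im / ((1 - t ^ k * z.re) ^ 2 + (t ^ k * z.im) ^ 2)) := by
    have : (k : ℂ) * (t : ℂ) ^ (k - 1) * z / (1 - z * (t : ℂ) ^ k) =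
        ((k * t ^ (k - 1) : ℝ) : ℂ) * (z / (1 - z * ((t ^ k : ℝ) : ℂ))) := by
      push_cast
      ring
    rw [this, Complex.im_ofReal_mul, rootsPF_div_im z (t ^ k)]
  calc ∑ j, (w j).im / ((1 - t * (w j).re) ^ 2 + (t * (w j).im) ^ 2)
      = ∑ j, (w j / (1 - w j * (t : ℂ))).im :=
        Finset.sum_congr rfl fun j _ => (rootsPF_div_im (w j) t).symm
    _ = (∑ j, w j / (1 - w j * (t : ℂ))).im := (Complex.im_sum _ _).symm
    _ = k * t ^ (k - 1) * (z.im / ((1 - t ^ k * z.re) ^ 2 + (t ^ k * z.im) ^ 2)) := by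
        rw [hC, hR]

end Summit.KontsevichZagierPeriods.HyperbolicBloch.OffTetraSectorKernel
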